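import Literature.MathematicalPhysics.QuantumLattice.BogoliubovInequalityGeneral
import Literature.MathematicalPhysics.QuantumLattice.GibbsEnergyEntropyBalance
import HarnessLib

/-!
# Bogoliubov rows for canonical Gibbs eigen-mixtures: full space and invariant coordinate sector

Companion of `BogoliubovInequalityGeneral.lean` (the general-operator Bogoliubov inequality of
Dyson–Lieb–Simon, [DLS1978] eq. (28), in its LINEAR row form `bogoliubov_row_nonneg`) and of
`GibbsEnergyEntropyBalance.lean` (the linearised energy–entropy-balance rows written for canonical
Gibbs EIGEN-MIXTURES, the format consumed by the torus-limit readers of the Hubbard `T > 0`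
certificate family). This file rewrites the Bogoliubov row in that same eigen-mixture format:

* §1 (full space) `sum_exp_mul_re_expect_bog_nonneg`: for `H` Hermitian with Mathlib eigenbasis
  `v_a` (`eigenvectorUnitary`) and eigenvalues `E_a`, all matrices `B`, `C` and `β ≥ 0`:
  `0 ≤ Σ_a e^{−βE_a} Re⟨v_a, G v_a⟩`,
  `G = BBᴴ + BᴴB + 2·(CB − BC) + (β/2)·(Cᴴ(HC − CH) − (HC − CH)Cᴴ)` — i.e.
  `Z · (Re⟨BBᴴ + BᴴB⟩_β + 2 Re⟨CB − BC⟩_β + ½β Re⟨[Cᴴ,[H,C]]⟩_β) ≥ 0`, Bogoliubov's inequality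
  ([DLS1978] (28)) after AM–GM;
* §2 (coordinate sector `p`, the format of `TorusSectorGibbsMixture`: `A` Hermitian with no entries
  between `p` and its complement, canonical weights of the compression)
  `sum_canonicalWeight_mul_re_expect_bog_nonneg` — the same row for the canonical sector Gibbs
  state `tr(P_p e^{−βA} ·)/Z_p`, for all `B`, `C` that together with their adjoints map the sector
  into itself (for the Hubbard torus: particle-number preserving words).

Everything is PROVED; no definition, no named fact. Passage to torus-limit states is the clone of
the `eeb` reader (`TorusGibbsEnergyEntropyBalance.lean`) and is not included here.

## References

* [DLS1978] F. J. Dyson, E. H. Lieb, B. Simon, J. Stat. Phys. 18 (1978) 335–383, §2 eq. (28)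
  (Bogoliubov's inequality for arbitrary operators) — held `paper:doi-10-1007-978-3-662-10018-9-12`.
* H. Fawzi, O. Fawzi, S. O. Scalet, arXiv:2311.18706, Thm. 3.4 (matrix energy–entropy balance; it
  implies these rows on the same operator span, hubbard-thermal THERMAL-SOURCES §2g (G-5)).

## Mathlib / tree search

REUSED: tree `bogoliubov_row_nonneg` (BogoliubovInequalityGeneral), `trace_gibbsWeight_mul_eq_sum`
(GibbsTwoTimeBound), `Matrix.IsHermitian.re_gibbsState` (DuhamelTwoPoint), `sectorExtend`,
`sectorEigenvector`, `sectorEigenvalue`, `canonicalWeight` (TorusSectorGibbsMixture),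
`mul_apply_eq_zero_off` (GibbsEnergyEntropyBalance). The compression plumbing
(`star_sectorExtend_dotProduct_mulVec_sectorExtend`, `submatrix_mul_of_apply_eq_zero_off`) is
private in `GibbsEnergyEntropyBalance.lean` and re-proved here privately.
-/

noncomputable section

namespace Literature.MathematicalPhysics.QuantumLattice

open Matrix Finset
open scoped ComplexOrder BigOperators Matrix.Norms.L2Operator

/-! ### §1 Full space -/

section FullSpace

variable {κ : Type*} [Fintype κ] [DecidableEq κ]

omit [DecidableEq κ] in
/-- A diagonal entry of `Vᴴ X V` is the expectation of `X` in the corresponding column of `V`.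
[folklore] -/
private theorem conjTranspose_mul_mul_apply_same_bog (V X : Matrix κ κ ℂ) (a : κ) :
    (Vᴴ * X * V) a a = star (fun i => V i a) ⬝ᵥ (X *ᵥ fun i => V i a) := by
  rw [Matrix.mul_assoc, Matrix.mul_apply]
  simp only [conjTranspose_apply, dotProduct, Pi.star_apply, mulVec, Matrix.mul_apply]

/-- **Real part of a Gibbs expectation as an eigen-mixture**:
`Re⟨X⟩_β = Z⁻¹ Σ_a e^{−βE_a} Re⟨v_a, X v_a⟩`. [folklore] -/
private theorem re_gibbsState_eq_sum_eigenvector {H : Matrix κ κ ℂ} (hH : H.IsHermitian) (β : ℝ)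
    (X : Matrix κ κ ℂ) :
    (gibbsState β H X).re = (∑ a, Real.exp (-(β * hH.eigenvalues a)))⁻¹ *
      ∑ a, Real.exp (-(β * hH.eigenvalues a)) *
        (star (fun i => (hH.eigenvectorUnitary : Matrix κ κ ℂ) i a) ⬝ᵥ
          (X *ᵥ fun i => (hH.eigenvectorUnitary : Matrix κ κ ℂ) i a)).re := by
  rw [hH.re_gibbsState β X, trace_gibbsWeight_mul_eq_sum hH β X, Complex.re_sum]
  refine congrArg (fun t => (∑ a, Real.exp (-(β * hH.eigenvalues a)))⁻¹ * t) ?_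
  refine sum_congr rfl fun a _ => ?_
  rw [Matrix.star_eq_conjTranspose, conjTranspose_mul_mul_apply_same_bog, Complex.re_ofReal_mul,
    neg_mul]

/-- **Bogoliubov row for the canonical eigen-mixture of a Hermitian matrix (Boltzmann weights,
unnormalised).** Let `H` be Hermitian with orthonormal eigenbasis `v_a` (columns of
`Matrix.IsHermitian.eigenvectorUnitary`) and eigenvalues `E_a`, let `B`, `C` be any matrices and
`β ≥ 0`. Then
`0 ≤ Σ_a e^{−βE_a} · Re ⟨v_a, (BBᴴ + BᴴB + 2·(CB − BC) + (β/2)·(Cᴴ(HC − CH) − (HC − CH)Cᴴ)) v_a⟩`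
— this is `Z` times the linear row form of Bogoliubov's inequality
`0 ≤ Re⟨BBᴴ + BᴴB⟩ + 2Re⟨CB − BC⟩ + ½β Re⟨[Cᴴ,[H,C]]⟩` for the Gibbs state `tr(e^{−βH}·)/Z`
(`bogoliubov_row_nonneg`). [cite: DLS1978, §2 eq. (28)] -/
theorem sum_exp_mul_re_expect_bog_nonneg {H : Matrix κ κ ℂ} (hH : H.IsHermitian)
    (B C : Matrix κ κ ℂ) {β : ℝ} (hβ : 0 ≤ β) :
    0 ≤ ∑ a, Real.exp (-(β * hH.eigenvalues a)) *
      (star (fun i => (hH.eigenvectorUnitary : Matrix κ κ ℂ) i a) ⬝ᵥ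
        ((B * Bᴴ + Bᴴ * B + ((2 : ℝ) : ℂ) • (C * B - B * C) +
            ((β / 2 : ℝ) : ℂ) • (Cᴴ * (H * C - C * H) - (H * C - C * H) * Cᴴ)) *ᵥ
          fun i => (hH.eigenvectorUnitary : Matrix κ κ ℂ) i a)).re := by
  rcases isEmpty_or_nonempty κ with hκ | hκ
  · simp
  have hZ : 0 < ∑ a, Real.exp (-(β * hH.eigenvalues a)) :=
    Finset.sum_pos (fun _ _ => Real.exp_pos _) Finset.univ_nonempty
  have hrow := bogoliubov_row_nonneg hH B C hβ
  have hlin : (gibbsState β H (B * Bᴴ + Bᴴ * B)).re + 2 * (gibbsState β H (C * B - B * C)).re +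
      β / 2 * (gibbsState β H (Cᴴ * (H * C - C * H) - (H * C - C * H) * Cᴴ)).re =
      (gibbsState β H (B * Bᴴ + Bᴴ * B + ((2 : ℝ) : ℂ) • (C * B - B * C) +
        ((β / 2 : ℝ) : ℂ) • (Cᴴ * (H * C - C * H) - (H * C - C * H) * Cᴴ))).re := by
    simp only [map_add, map_smul, Complex.add_re, smul_eq_mul, Complex.re_ofReal_mul]
  rw [hlin, re_gibbsState_eq_sum_eigenvector hH] at hrow
  exact (mul_nonneg_iff_of_pos_left (inv_pos.2 hZ)).1 hrow

end FullSpace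

/-! ### §2 The same for the canonical eigen-mixture of a Hermitian matrix compressed to an
invariant coordinate sector (the format of `TorusSectorGibbsMixture`) -/

section CoordinateSector

variable {ι : Type*} [Fintype ι] [DecidableEq ι] (p : ι → Prop) [DecidablePred p]

omit [DecidableEq ι] in
/-- A sum over all coordinates of a function vanishing off the sector is the sum over the sector.
[folklore] -/
private theorem sum_eq_sum_subtype_of_eq_zero_off_bog (f : ι → ℂ) (hf : ∀ i, ¬ p i → f i = 0) :
    ∑ i, f i = ∑ a : Subtype p, f a.1 := by
  rw [← Finset.sum_subtype (Finset.univ.filter p) (by simp), Finset.sum_filter_of_ne]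
  intro i _ hi
  by_contra h
  exact hi (hf i h)

omit [DecidableEq ι] in
/-- **Expectations in an extended sector vector only see the compression**:
`⟨ext φ, X ext φ⟩ = ⟨φ, X|_p φ⟩`, `X|_p = X.submatrix val val`, for EVERY matrix `X`. [folklore] -/
private theorem star_sectorExtend_dotProduct_mulVec_sectorExtend_bog (X : Matrix ι ι ℂ)
    (φ : Subtype p → ℂ) :
    star (sectorExtend p φ) ⬝ᵥ (X *ᵥ sectorExtend p φ) =
      star φ ⬝ᵥ (X.submatrix (Subtype.val : Subtype p → ι) Subtype.val *ᵥ φ) := by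
  have hext : ∀ a : Subtype p, sectorExtend p φ a.1 = φ a := fun a => by simp [sectorExtend, a.2]
  have hoff : ∀ i, ¬ p i → sectorExtend p φ i = 0 := fun i hi => by simp [sectorExtend, hi]
  rw [dotProduct, dotProduct, sum_eq_sum_subtype_of_eq_zero_off_bog p]
  · refine Finset.sum_congr rfl fun a _ => ?_
    rw [Pi.star_apply, Pi.star_apply, hext, mulVec, mulVec, dotProduct, dotProduct,
      sum_eq_sum_subtype_of_eq_zero_off_bog p]
    · simp only [Matrix.submatrix_apply, hext]
    · intro j hj
      rw [hoff j hj, mul_zero]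
  · intro i hi
    rw [Pi.star_apply, hoff i hi, star_zero, zero_mul]

omit [DecidableEq ι] in
/-- If the right factor has no entries from the sector into its complement, compression is
multiplicative: `(M N)|_p = M|_p N|_p`. [folklore] -/
private theorem submatrix_mul_of_apply_eq_zero_off_bog (M N : Matrix ι ι ℂ)
    (hN : ∀ i j, ¬ p i → p j → N i j = 0) :
    (M * N).submatrix (Subtype.val : Subtype p → ι) (Subtype.val : Subtype p → ι) =
      M.submatrix (Subtype.val : Subtype p → ι) (Subtype.val : Subtype p → ι) *
        N.submatrix (Subtype.val : Subtype p → ι) (Subtype.val : Subtype p → ι) := by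
  ext a b
  rw [Matrix.submatrix_apply, Matrix.mul_apply, Matrix.mul_apply,
    sum_eq_sum_subtype_of_eq_zero_off_bog p]
  · rfl
  · intro k hk
    rw [hN k b.1 hk b.2, mul_zero]

/-- **Bogoliubov row for the canonical sector Gibbs eigen-mixture.** Let `A` be Hermitian with no
entries between the coordinate sector `p` and its complement, `ψ_a` (`sectorEigenvector`) the
extended orthonormal eigenbasis of the compression with eigenvalues `E_a` (`sectorEigenvalue`) and
canonical weights `w_a = e^{−βE_a}/Z` (`canonicalWeight`). For all matrices `B`, `C` such that
`B`, `Bᴴ`, `C`, `Cᴴ` map the sector into itself and every `β ≥ 0`: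
`0 ≤ Σ_a w_a · Re ⟨ψ_a, (BBᴴ + BᴴB + 2·(CB − BC) + (β/2)·(Cᴴ(AC − CA) − (AC − CA)Cᴴ)) ψ_a⟩`
— Bogoliubov's inequality `|ρ([C,B])|² ≤ ½β ρ({B,B⋆}) ρ([C⋆,[A,C]])` in linear row form for the
canonical Gibbs state `ρ = tr(P_p e^{−βA} ·)/Z_p` of the sector and sector-preserving `B`, `C`
(compress to the sector and apply `sum_exp_mul_re_expect_bog_nonneg`: the canonical sector state is
the Gibbs state of the compressed Hamiltonian). [cite: DLS1978, §2 eq. (28)] -/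
theorem sum_canonicalWeight_mul_re_expect_bog_nonneg {A : Matrix ι ι ℂ} (hA : A.IsHermitian)
    (hinv : ∀ i j, ¬ p i → p j → A i j = 0) {B C : Matrix ι ι ℂ}
    (hB : ∀ i j, ¬ p i → p j → B i j = 0) (hB' : ∀ i j, ¬ p i → p j → Bᴴ i j = 0)
    (hC : ∀ i j, ¬ p i → p j → C i j = 0) (hC' : ∀ i j, ¬ p i → p j → Cᴴ i j = 0)
    {β : ℝ} (hβ : 0 ≤ β) :
    0 ≤ ∑ a, canonicalWeight β (sectorEigenvalue p A hA) a *
      (star (sectorEigenvector p A hA a) ⬝ᵥ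
        ((B * Bᴴ + Bᴴ * B + ((2 : ℝ) : ℂ) • (C * B - B * C) +
            ((β / 2 : ℝ) : ℂ) • (Cᴴ * (A * C - C * A) - (A * C - C * A) * Cᴴ)) *ᵥ
          sectorEigenvector p A hA a)).re := by
  set hAp := hA.submatrix (Subtype.val : Subtype p → ι) with hApdef
  set Ap : Matrix (Subtype p) (Subtype p) ℂ := A.submatrix (Subtype.val : Subtype p → ι) Subtype.val
    with hAp'
  set Bp : Matrix (Subtype p) (Subtype p) ℂ := B.submatrix (Subtype.val : Subtype p → ι) Subtype.val
    with hBp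
  set Cp : Matrix (Subtype p) (Subtype p) ℂ := C.submatrix (Subtype.val : Subtype p → ι) Subtype.val
    with hCp
  -- compression of the row observable
  have hBt : (Bᴴ).submatrix (Subtype.val : Subtype p → ι) Subtype.val = Bpᴴ := by
    rw [hBp, Matrix.conjTranspose_submatrix]
  have hCt : (Cᴴ).submatrix (Subtype.val : Subtype p → ι) Subtype.val = Cpᴴ := by
    rw [hCp, Matrix.conjTranspose_submatrix]
  have hAC : ∀ i j, ¬ p i → p j → (A * C - C * A) i j = 0 := fun i j hi hj => by
    rw [Matrix.sub_apply, mul_apply_eq_zero_off p hinv hC i j hi hj,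
      mul_apply_eq_zero_off p hC hinv i j hi hj, sub_zero]
  have hsub : ((B * Bᴴ + Bᴴ * B + ((2 : ℝ) : ℂ) • (C * B - B * C) +
        ((β / 2 : ℝ) : ℂ) • (Cᴴ * (A * C - C * A) - (A * C - C * A) * Cᴴ))).submatrix
          (Subtype.val : Subtype p → ι) Subtype.val =
      (Bp * Bpᴴ + Bpᴴ * Bp + ((2 : ℝ) : ℂ) • (Cp * Bp - Bp * Cp) +
        ((β / 2 : ℝ) : ℂ) • (Cpᴴ * (Ap * Cp - Cp * Ap) - (Ap * Cp - Cp * Ap) * Cpᴴ)) := by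
    simp only [Matrix.submatrix_add, Matrix.submatrix_sub, Matrix.submatrix_smul, Pi.add_apply,
      Pi.sub_apply, Pi.smul_apply, submatrix_mul_of_apply_eq_zero_off_bog p B Bᴴ hB',
      submatrix_mul_of_apply_eq_zero_off_bog p Bᴴ B hB,
      submatrix_mul_of_apply_eq_zero_off_bog p C B hB, submatrix_mul_of_apply_eq_zero_off_bog p B C hC,
      submatrix_mul_of_apply_eq_zero_off_bog p Cᴴ (A * C - C * A) hAC,
      submatrix_mul_of_apply_eq_zero_off_bog p (A * C - C * A) Cᴴ hC',
      submatrix_mul_of_apply_eq_zero_off_bog p A C hC, submatrix_mul_of_apply_eq_zero_off_bog p C A hinv,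
      hBt, hCt, ← hAp', ← hBp, ← hCp]
  -- each term is the corresponding full-space term of the compression
  have hterm : ∀ a : Subtype p,
      (star (sectorEigenvector p A hA a) ⬝ᵥ
        ((B * Bᴴ + Bᴴ * B + ((2 : ℝ) : ℂ) • (C * B - B * C) +
            ((β / 2 : ℝ) : ℂ) • (Cᴴ * (A * C - C * A) - (A * C - C * A) * Cᴴ)) *ᵥ
          sectorEigenvector p A hA a)) =
      star (fun b => (hAp.eigenvectorUnitary : Matrix (Subtype p) (Subtype p) ℂ) b a) ⬝ᵥ
        ((Bp * Bpᴴ + Bpᴴ * Bp + ((2 : ℝ) : ℂ) • (Cp * Bp - Bp * Cp) +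
            ((β / 2 : ℝ) : ℂ) • (Cpᴴ * (Ap * Cp - Cp * Ap) - (Ap * Cp - Cp * Ap) * Cpᴴ)) *ᵥ
          fun b => (hAp.eigenvectorUnitary : Matrix (Subtype p) (Subtype p) ℂ) b a) := by
    intro a
    rw [sectorEigenvector, star_sectorExtend_dotProduct_mulVec_sectorExtend_bog, hsub]
  have hw : ∀ a : Subtype p, canonicalWeight β (sectorEigenvalue p A hA) a =
      (∑ b, Real.exp (-(β * hAp.eigenvalues b)))⁻¹ * Real.exp (-(β * hAp.eigenvalues a)) :=
    fun a => rfl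
  simp_rw [hterm, hw, mul_assoc, ← Finset.mul_sum]
  exact mul_nonneg (inv_nonneg.2 (Finset.sum_nonneg fun _ _ => (Real.exp_pos _).le))
    (sum_exp_mul_re_expect_bog_nonneg hAp Bp Cp hβ)

end CoordinateSector

end Literature.MathematicalPhysics.QuantumLattice

end
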